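import Summits.BirchSwinnertonDyer.BirchSwinnertonDyer.Theorems.ClassRecordThreeLambdaMatchingTransferRational
import Summits.BirchSwinnertonDyer.BirchSwinnertonDyer.Theorems.ErratumRoadFiveIMCDivClassicalBLambdaMatching
import Summits.BirchSwinnertonDyer.BirchSwinnertonDyer.Theorems.UniversalToricDescentBDPFrameCrossPeriodRigidity
import Summits.BirchSwinnertonDyer.BirchSwinnertonDyer.Theorems.SchneiderFreeAdditiveX3GordTwoBranchIMCDivOfKY
import Summits.BirchSwinnertonDyer.Rank1Residual.Partition.IrreducibleOverQuadraticField
import Summits.BirchSwinnertonDyer.Rank1Residual.X11b.EmbeddingDatumPrime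
import Literature.NumberTheory.EllipticCurves.BurungaleCastellaSkinner2025.BDPMainConjecture
import HarnessLib

/-!
# ROAD B12 at `p ≥ 5` (route `ErratumRoadFive`, classical-data residuals 19702 `Rest3TorsionBranchAtFive`,
# 19282 `OpenInputNotRam`, 19703 `Rest3NoWitnessBranchAtFive`): the INV input of the classical B-atom
# (2.4)∃♭ᴮ FROM ITS SOURCES at every admissible field `K ≠ ℚ(√−3)` — Burungale–Castella–Skinner 2025
# Thm 1.2.4 (b) (INTEGRAL clause) for a good-ordinary `p`-congruent PARTNER with surjective `ρ̄`, Prop 4.2.2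
# (`μ(L_p^BDP) = 0`), the Euler-side divisibility UB♯ for `E`, and the partner-transfer data TRANSFER —
# the `p ≥ 5` twin of `ClassRecordThreeIMCDivTwoLociAtThreeRFromThm57Transfer.lean` (p554219, `p = 3`)

Cell `bsd-stepL` (run/shared/lean/pub/bsd-stepL/), seat `bsd-stepL-bdp` (prover g24, 2026-08-27). `--supports
stmt-BirchSwinnertonDyer-19702 --as helper`. THEOREMS ONLY (no definition, no named fact, no `sorry`). Memo:
HOME/proof/PROOF-BDP.md §57 (57.1 chain; 57.10: K-uniform RATIONAL partners at `p = 5` on ≥ 2 082 ∕ 11 861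
finite-flat targets; 57.12: the `ℚ(√−3)` typed-shape caveat) and §60 (this file).

WHY A GUARD. The classical B-atom `P2.IMCDivSomeFrameOnTreeB W p` (bdp g16) and the registered B-stubs it decides
(`stub_t_imcDivSomeFrameB` of 19702, `stub_imcDivSomeFrameNotRamB` of 19282) quantify over every imaginary
quadratic `K` with `Odd d_K`, `p ∤ d_K`, `p ∤ #𝓞_K^×`, Heegner for `N` — which at `p ≥ 5` ADMITS `K = ℚ(√−3)`
(whenever `p ≡ 1 (mod 3)` and every `ℓ ∣ N` is `≡ 1 (mod 3)`). Neither printed anchor serves that field: BCS25's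
(disc) is «`D_K` odd and `≠ −3`» (and the cell's UB, PROOF-BDP §43, carries the same choice). At `p = 3` the datum
excludes `ℚ(√−3)` by itself (`3 ∤ d_K`), which is why p554219 concludes the `@3` stub VERBATIM. Here every shape
carries ONE extra binder `NumberField.discr K ≠ -3`, placed right after `Odd (NumberField.discr K)` (BCS25's
(disc) order); otherwise the binders are those of the atom (p498117) ∕ of p507771's FRAME ∕ UB ∕ INV VERBATIM.
If the planner adds the guard to the B-stubs (PROOF-BDP 57.12 option (α)), the by-name displays follow from this
file in one short step; under option (β) this file IS the honest kernel object (a helper).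

THE FOUR HYPOTHESES (over the guarded binders; `W`, `p` fixed):
* `h124 : BurungaleCastellaSkinner2025.thm124b_exists_isBDPLFunction_isTorsion_charIdeal_eq` — PRINT (IMRN 2025
  Thm 1.2.4 (b): for `(E′, p, K)` with `p > 3` good ordinary, (sur), (disc), (Heeg), (spl): `ch_Λ(X_Gr)·Λ^{ur} =
  (L_p^BDP)` INTEGRALLY), applied to the PARTNER `W′` — a rational `p`-congruent good-ordinary curve has
  `ρ̄_{W′,p} = ρ̄_{W,p}` onto, so (sur) is automatic for it (it is a conjunct of TRANSFER); flag D1 inherited.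
* `h422 : BurungaleCastellaSkinner2025.prop422_exists_isBDPLFunction_mu_eq_zero` — PRINT (`μ(L_p^BDP(W′∕K)) = 0`,
  Prop 4.2.2 after Hsieh 2014 Thm B); its frame is carried to Thm 1.2.4's frame by the tree's integral cross-period
  rigidity `UniversalToricDescentTwinSplit.span_singleton_eq_of_isBDPLFunction`.
* UB♯|ᵍ — for every `R₀`-frame `L` at `(ι′, 𝔭_{ι′})` and every X-slot `𝔭bar ∋ p`, `𝔭bar ≠ 𝔭_{ι′}`:
  `L ∈ Ch_Λ(X_ac 𝔭bar)·R₀⟦T⟧` (`k = 0`; PROOF-BDP §55 THEOREM UB, memo-proved at every odd `p ∥ N`, refereed g44–g54).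
* TRANSFER|ᵍ — at each such frame and slot: a PARTNER `W′` (good ordinary at `p`, `ρ̄_{W′,p}` onto, Heegner for the
  SAME `K` at its level `N′`) such that for all generators `g, g′` of the two characteristic ideals at `𝔭bar` and
  every BDP frame `L′` of `W′` at `(ι′, 𝔭_{ι′})`: Σ-factors `P, P′` with `μ = 0`, a unit `u`, the ANALYTIC
  CONGRUENCE `u·L′·P′ ≡ L·P (mod 𝔪)` (PROOF-BDP §40), the residual `μ`-TRANSFER and the residual `λ`-EQUALITY
  (PROOF-BDP §37.11; their two joints written out in §58) — bricks (ε4) + (ε2) of §37.2 and nothing else.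

CONTENTS (PART 1 of 2): §1 `P2.invariantsMatch_guarded_of_thm124b_of_upperDivisibility_of_transfer` (INV|ᵍ);
§2 `P2.ratUpperBound_guarded_of_upperDivisibility` (UB|ᵍ in the atom's `∃ k` currency, `k := 0`). PART 2
(`ErratumRoadFiveIMCDivClassicalBGuardedAtomFromThm124bTransfer.lean`): the atom's display at every guarded datum
from FRAME + UB♯|ᵍ + INV|ᵍ (p507771's per-datum equality and last mile), and from the two PRINT facts + FRAME +
UB♯|ᵍ + TRANSFER|ᵍ.

HONEST FRAMING: CONDITIONAL theorems; UB♯ and TRANSFER are OPEN typed shapes (memo-proved: §55 resp. §40 ∕ §37.11;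
a partner EXISTS only on the finite-flat locus `p ∣ v_p(Δ_min)` — 40 799 class-wide pairs at `p ≥ 5`, among them
ALL 3 687 pairs of 19702 (57.2); K-uniform RATIONAL partners certified-by-table on ≥ 2 082 ∕ 11 861 finite-flat
targets at `p = 5` (57.10); elsewhere on that locus the partner is Ribet's level-lowered NEWFORM, for which no typed
anchor exists — scope question Q57-1); `h124` ∕ `h422` are named PRINT facts carried by name (flag D1
`BCS25-IMC-equiv@BSTW` on `h124`); the guard `d_K ≠ −3` makes every conclusion STRICTLY WEAKER than the registered
stub shapes; nothing is discharged, booked or re-labelled (T7); BSD is proved for no pair.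

References: arXiv:2405.00270v2 = IMRN 2025 rnaf082, Thm. 1.2.4 (b), Prop. 4.2.2; [Hsieh2014] Thm. B; [Washington1997]
§7.1 Prop. 7.2, §13.2; [EmertonPollackWeston2006] Thm. 1; [GreenbergVatsal2000] Prop. 2.4; [Castella2018] Thm. 3.1;
[Castella2018Erratum] (2.4); PROOF-BDP §37, §40, §55, §57, §58, §60.
-/

set_option autoImplicit false

noncomputable section

open scoped Classical NumberField

open WeierstrassCurve NumberField IsDedekindDomain Field PowerSeries
open Literature.NumberTheory.EllipticCurves Literature.NumberTheory.EllipticCurves.GreenbergSelmer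
open Literature.NumberTheory.EllipticCurves.ModularForms
open Literature.NumberTheory.EllipticCurves.Rank1Residual
open Literature.NumberTheory.EllipticCurves.Castella2018
open Literature.NumberTheory.GaloisRepresentations Literature.NumberTheory.GaloisCohomology
open Summit.BirchSwinnertonDyer.Rank1Residual.X11b.AcSelmer
open Summit.BirchSwinnertonDyer.Rank1Residual.X11b.Halves
open Summit.BirchSwinnertonDyer.Rank1Residual.X1.KellerYinHalves
open Summit.BirchSwinnertonDyer.BirchSwinnertonDyer.Theorems
open Summit.BirchSwinnertonDyer.BirchSwinnertonDyer.Theorems.LambdaMatching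
open Summit.BirchSwinnertonDyer.BirchSwinnertonDyer.Theorems.UniversalToricDescentTwinSplit
open Summit.BirchSwinnertonDyer.BirchSwinnertonDyer.Theorems.SchneiderFree

namespace Summit.BirchSwinnertonDyer.Rank1Residual.X11b

variable {W : WeierstrassCurve ℚ} [W.IsElliptic] {p : ℕ} [Fact p.Prime]

/-! ### §1 INV|ᵍ ⟸ {BCS25 Thm 1.2.4 (b), Prop 4.2.2, UB♯|ᵍ, TRANSFER|ᵍ} -/

/-- **INV at every admissible `K ≠ ℚ(√−3)` ⟸ {BCS25 Thm 1.2.4 (b), Prop 4.2.2, UB♯|ᵍ, TRANSFER|ᵍ}** (the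
`p ≥ 5` twin of `LambdaMatchingAtThree.inv3_of_thm57_of_upperDivisibility_of_transfer`). At each guarded datum,
frame `L` and X-slot `𝔭bar`: pick generators `g`, `g′` of `Ch_Λ(X_ac(E) 𝔭bar)` and of the partner's; `p ∣ N`
splits in the Heegner field, so `𝔭_{ι′}` has degree one and (spl) holds; Thm 1.2.4 (b) for `(W′, K)` at
`(v, v̄) = (𝔭_{ι′}, 𝔭bar)` gives a frame `L₀` with `(map g′) = (L₀)` INTEGRALLY along `toUnr p`; Prop 4.2.2 gives
`μ(L₀) = 0` (via cross-period rigidity); TRANSFER at `(g, g′, L₀)` and UB♯ feed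
`LambdaMatching.invariantsMatch_of_transfer_rational` (p551362, with `k = k′ = 0`), which returns
FU(map g, n) ∧ FU(L, n). CONDITIONAL; nothing booked.
[cite: BurungaleCastellaSkinner2025, Thm. 1.2.4 (b) and Prop. 4.2.2 (arXiv:2405.00270v2 pp. 3, 8–9)]
[cite: Washington1997, §7.1 Prop. 7.2 and §13.2] [cite: EmertonPollackWeston2006, Thm. 1 (the mechanism)] -/
theorem P2.invariantsMatch_guarded_of_thm124b_of_upperDivisibility_of_transfer
    (h124 : BurungaleCastellaSkinner2025.thm124b_exists_isBDPLFunction_isTorsion_charIdeal_eq)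
    (h422 : BurungaleCastellaSkinner2025.prop422_exists_isBDPLFunction_mu_eq_zero)
    (hUB : ∀ (N : ℕ) [NeZero N] (K : Type) [Field K] [NumberField K]
      (Dt : ModularParametrizationData W N) (H : HeegnerDatum N (NumberField.discr K)) (ι : K →+* ℂ)
      (P : (W.baseChange K).toAffine.Point),
      ClassX11b W p → 5 ≤ p → Surj W p → W.conductorNorm ℤ = N → IsImaginaryQuadratic K →
      Odd (NumberField.discr K) → NumberField.discr K ≠ -3 → ¬ (p : ℤ) ∣ NumberField.discr K →
      ¬ p ∣ Units.torsionOrder K → SatisfiesHeegnerHypothesis N K →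
      (W.quadraticTwist (NumberField.discr K : ℚ)).entireLFunction 1 ≠ 0 →
      WeierstrassCurve.Affine.Point.map ι.toRatAlgHom P = heegnerPointComplex Dt H →
      ¬ (p : ℤ) ∣ Dt.c → ¬ IsOfFinAddOrder P →
      ∀ (κ : ZpExtension K p), κ.IsAnticyclotomic →
        ∀ (γ : Field.absoluteGaloisGroup K) [Fact (κ.IsTopGenerator γ)]
          (ι' : PadicAlgCl p ≃+* ℂ) (w₀ : InfinitePlace K) (P' : (W.baseChange K).toAffine.Point),
          WeierstrassCurve.Affine.Point.map w₀.embedding.toRatAlgHom P' = heegnerPointComplex Dt H →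
          ∀ (e : K →+* ℚ_[p]),
            (∀ k : 𝓞 K, k ∈ (primeOfEmbeddingDatum p ι' w₀.embedding).asIdeal ↔ ‖e (k : K)‖ < 1) →
            ∀ (ΩK : ℂ) (Ωp : (unrIntegers p)ˣ) (L : UnrSeries p), ΩK ≠ 0 →
              IsBDPLFunction ι' (primeOfEmbeddingDatum p ι' w₀.embedding) κ γ Dt.f ΩK
                ((Ωp : unrIntegers p) : ℂ_[p]) L →
              ∀ (𝔭bar : HeightOneSpectrum (𝓞 K)), ((p : ℕ) : 𝓞 K) ∈ 𝔭bar.asIdeal →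
                𝔭bar ≠ primeOfEmbeddingDatum p ι' w₀.embedding →
                L ∈ (XAc.charIdeal (W.baseChange K) p κ 𝔭bar ∅ γ).map (PowerSeries.map (toUnr p)))
    (hTR : ∀ (N : ℕ) [NeZero N] (K : Type) [Field K] [NumberField K]
      (Dt : ModularParametrizationData W N) (H : HeegnerDatum N (NumberField.discr K)) (ι : K →+* ℂ)
      (P : (W.baseChange K).toAffine.Point),
      ClassX11b W p → 5 ≤ p → Surj W p → W.conductorNorm ℤ = N → IsImaginaryQuadratic K →
      Odd (NumberField.discr K) → NumberField.discr K ≠ -3 → ¬ (p : ℤ) ∣ NumberField.discr K →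
      ¬ p ∣ Units.torsionOrder K → SatisfiesHeegnerHypothesis N K →
      (W.quadraticTwist (NumberField.discr K : ℚ)).entireLFunction 1 ≠ 0 →
      WeierstrassCurve.Affine.Point.map ι.toRatAlgHom P = heegnerPointComplex Dt H →
      ¬ (p : ℤ) ∣ Dt.c → ¬ IsOfFinAddOrder P →
      ∀ (κ : ZpExtension K p), κ.IsAnticyclotomic →
        ∀ (γ : Field.absoluteGaloisGroup K) [Fact (κ.IsTopGenerator γ)]
          (ι' : PadicAlgCl p ≃+* ℂ) (w₀ : InfinitePlace K) (P' : (W.baseChange K).toAffine.Point),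
          WeierstrassCurve.Affine.Point.map w₀.embedding.toRatAlgHom P' = heegnerPointComplex Dt H →
          ∀ (e : K →+* ℚ_[p]),
            (∀ k : 𝓞 K, k ∈ (primeOfEmbeddingDatum p ι' w₀.embedding).asIdeal ↔ ‖e (k : K)‖ < 1) →
            ∀ (ΩK : ℂ) (Ωp : (unrIntegers p)ˣ) (L : UnrSeries p), ΩK ≠ 0 →
              IsBDPLFunction ι' (primeOfEmbeddingDatum p ι' w₀.embedding) κ γ Dt.f ΩK
                ((Ωp : unrIntegers p) : ℂ_[p]) L →
              ∀ (𝔭bar : HeightOneSpectrum (𝓞 K)), ((p : ℕ) : 𝓞 K) ∈ 𝔭bar.asIdeal →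
                𝔭bar ≠ primeOfEmbeddingDatum p ι' w₀.embedding →
                ∃ (W' : WeierstrassCurve ℚ) (_ : W'.IsElliptic) (_ : W'.IsGloballyMinimal) (N' : ℕ)
                  (_ : NeZero N') (Dt' : ModularParametrizationData W' N'),
                  GoodOrd W' p ∧ Surj W' p ∧ SatisfiesHeegnerHypothesis N' K ∧
                  ∀ (g g' : IwasawaAlgebra p),
                    XAc.charIdeal (W.baseChange K) p κ 𝔭bar ∅ γ = Ideal.span {g} →
                    XAc.charIdeal (W'.baseChange K) p κ 𝔭bar ∅ γ = Ideal.span {g'} →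
                    ∀ (ΩK' : ℂ) (Ωp' : (unrIntegers p)ˣ) (L' : UnrSeries p), ΩK' ≠ 0 →
                      IsBDPLFunction ι' (primeOfEmbeddingDatum p ι' w₀.embedding) κ γ Dt'.f ΩK'
                        ((Ωp' : unrIntegers p) : ℂ_[p]) L' →
                      ∃ (P P' u : UnrSeries p) (m m' : ℕ),
                        (‖((coeff m P : unrIntegers p) : ℂ_[p])‖ = 1 ∧
                          ∀ i < m, ‖((coeff i P : unrIntegers p) : ℂ_[p])‖ < 1) ∧
                        (‖((coeff m' P' : unrIntegers p) : ℂ_[p])‖ = 1 ∧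
                          ∀ i < m', ‖((coeff i P' : unrIntegers p) : ℂ_[p])‖ < 1) ∧
                        IsUnit u ∧
                        (∀ i, ‖((coeff i (u * (L' * P')) : unrIntegers p) : ℂ_[p]) -
                          ((coeff i (L * P) : unrIntegers p) : ℂ_[p])‖ < 1) ∧
                        ((∃ a, (‖((coeff a (PowerSeries.map (toUnr p) g * P) : unrIntegers p) : ℂ_[p])‖ = 1 ∧
                            ∀ i < a, ‖((coeff i (PowerSeries.map (toUnr p) g * P) : unrIntegers p) :
                              ℂ_[p])‖ < 1)) →
                          ∃ a', (‖((coeff a' (PowerSeries.map (toUnr p) g' * P') : unrIntegers p) : ℂ_[p])‖ = 1 ∧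
                            ∀ i < a', ‖((coeff i (PowerSeries.map (toUnr p) g' * P') : unrIntegers p) :
                              ℂ_[p])‖ < 1)) ∧
                        (∀ a a', (‖((coeff a (PowerSeries.map (toUnr p) g * P) : unrIntegers p) : ℂ_[p])‖ = 1 ∧
                            ∀ i < a, ‖((coeff i (PowerSeries.map (toUnr p) g * P) : unrIntegers p) :
                              ℂ_[p])‖ < 1) →
                          (‖((coeff a' (PowerSeries.map (toUnr p) g' * P') : unrIntegers p) : ℂ_[p])‖ = 1 ∧
                            ∀ i < a', ‖((coeff i (PowerSeries.map (toUnr p) g' * P') : unrIntegers p) :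
                              ℂ_[p])‖ < 1) → a = a')) :
    ∀ (N : ℕ) [NeZero N] (K : Type) [Field K] [NumberField K]
      (Dt : ModularParametrizationData W N) (H : HeegnerDatum N (NumberField.discr K)) (ι : K →+* ℂ)
      (P : (W.baseChange K).toAffine.Point),
      ClassX11b W p → 5 ≤ p → Surj W p → W.conductorNorm ℤ = N → IsImaginaryQuadratic K →
      Odd (NumberField.discr K) → NumberField.discr K ≠ -3 → ¬ (p : ℤ) ∣ NumberField.discr K →
      ¬ p ∣ Units.torsionOrder K → SatisfiesHeegnerHypothesis N K →
      (W.quadraticTwist (NumberField.discr K : ℚ)).entireLFunction 1 ≠ 0 →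
      WeierstrassCurve.Affine.Point.map ι.toRatAlgHom P = heegnerPointComplex Dt H →
      ¬ (p : ℤ) ∣ Dt.c → ¬ IsOfFinAddOrder P →
      ∀ (κ : ZpExtension K p), κ.IsAnticyclotomic →
        ∀ (γ : Field.absoluteGaloisGroup K) [Fact (κ.IsTopGenerator γ)]
          (ι' : PadicAlgCl p ≃+* ℂ) (w₀ : InfinitePlace K) (P' : (W.baseChange K).toAffine.Point),
          WeierstrassCurve.Affine.Point.map w₀.embedding.toRatAlgHom P' = heegnerPointComplex Dt H →
          ∀ (e : K →+* ℚ_[p]),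
            (∀ k : 𝓞 K, k ∈ (primeOfEmbeddingDatum p ι' w₀.embedding).asIdeal ↔ ‖e (k : K)‖ < 1) →
            ∀ (ΩK : ℂ) (Ωp : (unrIntegers p)ˣ) (L : UnrSeries p), ΩK ≠ 0 →
              IsBDPLFunction ι' (primeOfEmbeddingDatum p ι' w₀.embedding) κ γ Dt.f ΩK
                ((Ωp : unrIntegers p) : ℂ_[p]) L →
              ∀ (𝔭bar : HeightOneSpectrum (𝓞 K)), ((p : ℕ) : 𝓞 K) ∈ 𝔭bar.asIdeal →
                𝔭bar ≠ primeOfEmbeddingDatum p ι' w₀.embedding →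
                ∃ (g : IwasawaAlgebra p) (n : ℕ),
                  XAc.charIdeal (W.baseChange K) p κ 𝔭bar ∅ γ = Ideal.span {g} ∧
                  (‖((coeff n (PowerSeries.map (toUnr p) g) : unrIntegers p) : ℂ_[p])‖ = 1 ∧
                    ∀ i < n, ‖((coeff i (PowerSeries.map (toUnr p) g) : unrIntegers p) : ℂ_[p])‖ < 1) ∧
                  (‖((coeff n L : unrIntegers p) : ℂ_[p])‖ = 1 ∧
                    ∀ i < n, ‖((coeff i L : unrIntegers p) : ℂ_[p])‖ < 1) := by
  intro N _ K _ _ Dt H ι P hX h5 hs hN hK hodd hd3 hpd hμK hHN hLt hP hc hPinf κ hκ γ _ ι' w₀ P' hP' e he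
    ΩK Ωp L hΩK hL 𝔭bar h𝔭bar hne
  -- the partner and its transfer data
  obtain ⟨W', hE', hGM', N', hN', Dt', hord, hsurjW', hH', htr⟩ := hTR N K Dt H ι P hX h5 hs hN hK hodd hd3 hpd
    hμK hHN hLt hP hc hPinf κ hκ γ ι' w₀ P' hP' e he ΩK Ωp L hΩK hL 𝔭bar h𝔭bar hne
  -- generators of the two characteristic ideals
  obtain ⟨g, hg⟩ : ∃ g : IwasawaAlgebra p, XAc.charIdeal (W.baseChange K) p κ 𝔭bar ∅ γ = Ideal.span {g} :=
    (charIdeal_isPrincipal_holds p _).principal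
  obtain ⟨g', hg'⟩ : ∃ g' : IwasawaAlgebra p, XAc.charIdeal (W'.baseChange K) p κ 𝔭bar ∅ γ = Ideal.span {g'} :=
    (charIdeal_isPrincipal_holds p _).principal
  -- `p ∣ N` splits in the Heegner field `K`: `𝔭_{ι'}` has degree one, (spl) holds
  have hp3 : 3 < p := by omega
  have hp2 : 2 < p := by omega
  have h2 : Module.finrank ℚ K = 2 := hK.1
  have hmult : Mult W p := hX.2.2.1
  have hpN : p ∣ N := hN ▸ dvd_conductorNorm_of_mult hmult
  have hsplit : SplitsIn K p := hHN p Fact.out hpN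
  obtain ⟨he1, hf1⟩ := degreeOne_primeOfEmbeddingDatum p ι' h2 hsplit w₀.embedding
  have hspl : ((Ideal.span {(p : ℤ)}).primesOver (𝓞 K)).ncard = 2 :=
    ncard_primesOver_eq_two_of_degreeOne h2 (natCast_mem_primeOfEmbeddingDatum p ι' w₀.embedding) he1 hf1
  have hcompat := forall_mem_primeOfEmbeddingDatum_iff p ι' hK w₀
  have hirrK : (W'.baseChange K).HasIrreducibleModPGaloisRep p := irrK_of_surj W' p hsurjW' K h2
  -- BCS25 Thm 1.2.4 (b) for the partner: a frame `L₀` and the INTEGRAL equality along `toUnr p`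
  obtain ⟨ΩK₀, Ωp₀, L₀, hΩK₀, hL₀, -, heq⟩ :=
    h124 ι' W' K (primeOfEmbeddingDatum p ι' w₀.embedding) 𝔭bar κ γ Dt'.isNewformOf hp3 hord hsurjW' hK hH'
      hspl hodd hd3 hcompat h𝔭bar hne hκ
  have hbr : (XAc.charIdeal (W'.baseChange K) p κ 𝔭bar ∅ γ).map (PowerSeries.map (toUnr p)) =
      Ideal.span {PowerSeries.map (toUnr p) g'} := by rw [hg', Ideal.map_span, Set.image_singleton]
  have hbr' : (Literature.NumberTheory.EllipticCurves.Castella2018.AcSelmer.XAc.charIdeal (W'.baseChange K) p κ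
      𝔭bar ∅ γ).map (PowerSeries.map (toUnr p)) = Ideal.span {PowerSeries.map (toUnr p) g'} := by
    rw [← xac_charIdeal_eq_literature]; exact hbr
  have hint : Ideal.span ({PowerSeries.map (toUnr p) g'} : Set (UnrSeries p)) = Ideal.span {L₀} :=
    hbr'.symm.trans (heq (toUnr p) (coe_toUnr p))
  have hanc : C ((p : unrIntegers p) ^ 0) * L₀ ∈
      Ideal.span ({PowerSeries.map (toUnr p) g'} : Set (UnrSeries p)) := by
    rw [pow_zero, map_one, one_mul, hint]; exact Ideal.mem_span_singleton_self _
  have hanc' : C ((p : unrIntegers p) ^ 0) * PowerSeries.map (toUnr p) g' ∈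
      Ideal.span ({L₀} : Set (UnrSeries p)) := by
    rw [pow_zero, map_one, one_mul, ← hint]; exact Ideal.mem_span_singleton_self _
  -- the transfer data at `(g, g′, L₀)` and UB♯ at the datum
  obtain ⟨P₁, P₁', u, m, m', hP₁, hP₁', hu, hcong, hμ, hlam⟩ := htr g g' hg hg' ΩK₀ Ωp₀ L₀ hΩK₀ hL₀
  have hUB' : L ∈ Ideal.span ({PowerSeries.map (toUnr p) g} : Set (UnrSeries p)) := by
    have h := hUB N K Dt H ι P hX h5 hs hN hK hodd hd3 hpd hμK hHN hLt hP hc hPinf κ hκ γ ι' w₀ P' hP' e he ΩK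
      Ωp L hΩK hL 𝔭bar h𝔭bar hne
    rwa [hg, Ideal.map_span, Set.image_singleton] at h
  -- μ(L₀) = 0: BCS25 Prop 4.2.2 gives SOME frame `L₁` of the partner with a unit coefficient; the two frames
  -- generate the same ideal (cross-period rigidity), so `L₀` has one too
  obtain ⟨ΩK₁, Ωp₁, L₁, hΩK₁, hL₁, k₁, hk₁⟩ :=
    h422 ι' W' K (primeOfEmbeddingDatum p ι' w₀.embedding) κ γ Dt'.isNewformOf hp2 hord.1 hK hH' hspl hodd hd3
      hirrK (natCast_mem_primeOfEmbeddingDatum p ι' w₀.embedding) hcompat hκ Fact.out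
  have hΩp₀ : ((Ωp₀ : unrIntegers p) : ℂ_[p]) ≠ 0 := by
    intro h0
    have h1 := norm_coe_units_unrIntegers p Ωp₀
    rw [h0, norm_zero] at h1
    exact zero_ne_one h1
  have hΩp₁ : ((Ωp₁ : unrIntegers p) : ℂ_[p]) ≠ 0 := by
    intro h0
    have h1 := norm_coe_units_unrIntegers p Ωp₁
    rw [h0, norm_zero] at h1
    exact zero_ne_one h1
  have hspan : Ideal.span ({L₀} : Set (UnrSeries p)) = Ideal.span {L₁} :=
    span_singleton_eq_of_isBDPLFunction hK hκ Fact.out hΩK₁ hΩK₀ hΩp₁ hΩp₀ hL₁ hL₀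
  have hL₁FU : ∃ b ≤ k₁, (‖((coeff b L₁ : unrIntegers p) : ℂ_[p])‖ = 1 ∧
      ∀ i < b, ‖((coeff i L₁ : unrIntegers p) : ℂ_[p])‖ < 1) :=
    exists_firstUnitCoeffAt_of_exists_le ⟨k₁, le_rfl, by
      rw [(unrIntegers.isUnit_iff_norm_eq_one _).mp hk₁]; exact lt_irrefl _⟩
  obtain ⟨b, -, hL₁b⟩ := hL₁FU
  have hL₀b := firstUnitCoeffAt_of_span_singleton_eq hspan hL₁b
  obtain ⟨⟨n, hgn, hLn⟩, -⟩ :=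
    invariantsMatch_of_transfer_rational hanc hanc' hL₀b hP₁ hP₁' hu hcong hUB' hμ hlam
  exact ⟨g, n, hg, hgn, hLn⟩

/-! ### §2 UB|ᵍ (the atom's `∃ k` currency) ⟸ UB♯|ᵍ -/

omit [W.IsElliptic] in
/-- **UB|ᵍ (p507771's UB binder with the guard) ⟸ UB♯|ᵍ** (`k := 0`). [cite: Washington1997, §13.2] -/
theorem P2.ratUpperBound_guarded_of_upperDivisibility
    (hUB : ∀ (N : ℕ) [NeZero N] (K : Type) [Field K] [NumberField K]
      (Dt : ModularParametrizationData W N) (H : HeegnerDatum N (NumberField.discr K)) (ι : K →+* ℂ)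
      (P : (W.baseChange K).toAffine.Point),
      ClassX11b W p → 5 ≤ p → Surj W p → W.conductorNorm ℤ = N → IsImaginaryQuadratic K →
      Odd (NumberField.discr K) → NumberField.discr K ≠ -3 → ¬ (p : ℤ) ∣ NumberField.discr K →
      ¬ p ∣ Units.torsionOrder K → SatisfiesHeegnerHypothesis N K →
      (W.quadraticTwist (NumberField.discr K : ℚ)).entireLFunction 1 ≠ 0 →
      WeierstrassCurve.Affine.Point.map ι.toRatAlgHom P = heegnerPointComplex Dt H →
      ¬ (p : ℤ) ∣ Dt.c → ¬ IsOfFinAddOrder P →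
      ∀ (κ : ZpExtension K p), κ.IsAnticyclotomic →
        ∀ (γ : Field.absoluteGaloisGroup K) [Fact (κ.IsTopGenerator γ)]
          (ι' : PadicAlgCl p ≃+* ℂ) (w₀ : InfinitePlace K) (P' : (W.baseChange K).toAffine.Point),
          WeierstrassCurve.Affine.Point.map w₀.embedding.toRatAlgHom P' = heegnerPointComplex Dt H →
          ∀ (e : K →+* ℚ_[p]),
            (∀ k : 𝓞 K, k ∈ (primeOfEmbeddingDatum p ι' w₀.embedding).asIdeal ↔ ‖e (k : K)‖ < 1) →
            ∀ (ΩK : ℂ) (Ωp : (unrIntegers p)ˣ) (L : UnrSeries p), ΩK ≠ 0 →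
              IsBDPLFunction ι' (primeOfEmbeddingDatum p ι' w₀.embedding) κ γ Dt.f ΩK
                ((Ωp : unrIntegers p) : ℂ_[p]) L →
              ∀ (𝔭bar : HeightOneSpectrum (𝓞 K)), ((p : ℕ) : 𝓞 K) ∈ 𝔭bar.asIdeal →
                𝔭bar ≠ primeOfEmbeddingDatum p ι' w₀.embedding →
                L ∈ (XAc.charIdeal (W.baseChange K) p κ 𝔭bar ∅ γ).map (PowerSeries.map (toUnr p))) :
    ∀ (N : ℕ) [NeZero N] (K : Type) [Field K] [NumberField K]
      (Dt : ModularParametrizationData W N) (H : HeegnerDatum N (NumberField.discr K)) (ι : K →+* ℂ)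
      (P : (W.baseChange K).toAffine.Point),
      ClassX11b W p → 5 ≤ p → Surj W p → W.conductorNorm ℤ = N → IsImaginaryQuadratic K →
      Odd (NumberField.discr K) → NumberField.discr K ≠ -3 → ¬ (p : ℤ) ∣ NumberField.discr K →
      ¬ p ∣ Units.torsionOrder K → SatisfiesHeegnerHypothesis N K →
      (W.quadraticTwist (NumberField.discr K : ℚ)).entireLFunction 1 ≠ 0 →
      WeierstrassCurve.Affine.Point.map ι.toRatAlgHom P = heegnerPointComplex Dt H →
      ¬ (p : ℤ) ∣ Dt.c → ¬ IsOfFinAddOrder P →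
      ∀ (κ : ZpExtension K p), κ.IsAnticyclotomic →
        ∀ (γ : Field.absoluteGaloisGroup K) [Fact (κ.IsTopGenerator γ)]
          (ι' : PadicAlgCl p ≃+* ℂ) (w₀ : InfinitePlace K) (P' : (W.baseChange K).toAffine.Point),
          WeierstrassCurve.Affine.Point.map w₀.embedding.toRatAlgHom P' = heegnerPointComplex Dt H →
          ∀ (e : K →+* ℚ_[p]),
            (∀ k : 𝓞 K, k ∈ (primeOfEmbeddingDatum p ι' w₀.embedding).asIdeal ↔ ‖e (k : K)‖ < 1) →
            ∀ (ΩK : ℂ) (Ωp : (unrIntegers p)ˣ) (L : UnrSeries p), ΩK ≠ 0 →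
              IsBDPLFunction ι' (primeOfEmbeddingDatum p ι' w₀.embedding) κ γ Dt.f ΩK
                ((Ωp : unrIntegers p) : ℂ_[p]) L →
              ∀ (𝔭bar : HeightOneSpectrum (𝓞 K)), ((p : ℕ) : 𝓞 K) ∈ 𝔭bar.asIdeal →
                𝔭bar ≠ primeOfEmbeddingDatum p ι' w₀.embedding →
                ∃ k : ℕ, C (((p : ℕ) : unrIntegers p) ^ k) * L ∈
                  (XAc.charIdeal (W.baseChange K) p κ 𝔭bar ∅ γ).map (PowerSeries.map (toUnr p)) := by
  intro N _ K _ _ Dt H ι P hX h5 hs hN hK hodd hd3 hpd hμK hHN hLt hP hc hPinf κ hκ γ _ ι' w₀ P' hP' e he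
    ΩK Ωp L hΩK hL 𝔭bar h𝔭bar hne
  refine ⟨0, ?_⟩
  rw [pow_zero, map_one, one_mul]
  exact hUB N K Dt H ι P hX h5 hs hN hK hodd hd3 hpd hμK hHN hLt hP hc hPinf κ hκ γ ι' w₀ P' hP' e he ΩK Ωp L
    hΩK hL 𝔭bar h𝔭bar hne

end Summit.BirchSwinnertonDyer.Rank1Residual.X11b

end
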